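import Mathlib
import HarnessLib
import Summits.HubbardSuperconductivity.HubbardSuperconductivity.Theorems.KLProgrammeKLRegimeWickScaleFlowLines
import Summits.HubbardSuperconductivity.HubbardSuperconductivity.Theorems.KLProgrammeKLRegimeWickScaleFlowSlice

/-!
# Route `KLProgramme` — crux K3, ENGINE child gen 5 (stmt-HubbardSuperconductivity-19918 `KLRegimeEngineV14`), stub `stub_engine_step_values`,
# conjunct (E2-v9/v10) at `1 ≤ n`: the RUNG FUNCTIONS of the within-slice flow — tails and rates from monotonicity — `klws_softWeightPair_*`

Cell gate-hubbard-kl, seat hubbard-kl-k3c1-p1 (g6), technique «composed-map remainder propagation».  The weighted Duhamel comparison and its model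
instance (`kltc_riccati_duhamel_weighted` p500198, `klws_wickStep_of_scaleFlow` p505675) take rung functions `b, ḃ : [0,1] → (S × F → ℂ)` with
(`hb`) entrywise derivatives, (`hb'c`) continuous `ḃ`, (`hρ`) a TAIL PROFILE `‖b(1) − b(t)‖ ≤ ρ` and (`hβ`) a RATE `Σ‖ḃ(t)‖ ≤ βr`.  On the continuous
route the cumulative pp rung at cutoff `Λ` is, entry by entry, a fixed coefficient `c(x)` times the product of the two SOFT weights of the pair,
`u_Λ(x) = (1 − w_Λ(k))(1 − w_Λ(k′))` (`w_Λ = χ₂((ω²+e_K²)/Λ²)`, Salmhofer's weight of the fields above `Λ`; the pair's legs `k, k′`).  This file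
supplies the CALCULUS of that product along the affine scale path `Λ(t) = Λ₀ + t(Λ₁ − Λ₀)` (`0 < Λ₁ ≤ Λ₀`), generic in the two legs:

* §1 monotonicity: `klws_cutoffWeight_anti_scale` (`Λ ≤ Λ′ ⇒ w_{Λ′}(k) ≤ w_Λ(k)`), `klws_softWeight_mono_scale`, `klws_softWeight_mem_Icc`,
  **`klws_softWeightPair_antitoneOn_path`** (along the path the soft pair weight DECREASES);
* §2 generic tails from monotonicity: **`klws_rung_tail_le_of_antitone`** — for `b t a = c a · u t a` with `u · a` antitone on `[0,1]`:
  `‖b 1 a − b t a‖ ≤ ‖c a‖·(u 0 a − u 1 a)` — the tail profile IS the full increment (the Wick rung `g⊗g + g⊗D + D⊗g` of `klw_rung_pairs`);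
* §3 derivative and continuity: `klws_hasDerivAt_softWeightPair_path`, `klws_continuousOn_softWeightPair_deriv_path` (the `hb`, `hb'c` inputs for
  `b t x := c x · u_{Λ(t)}(x)`), the RATE BOUND `klws_abs_softWeightPair_deriv_le` (`|∂_t u| ≤ |Λ₁ − Λ₀|·(128/3)/Λ₁`, from `|ẇ_Λ| ≤ (64/3)/|Λ|`,
  `0 ≤ 1 − w ≤ 1`) and its SUPPORT `klws_softWeightPair_deriv_eq_zero` (zero unless one leg lies in the shell `Λ(t)²/4 ≤ ω² + e_K² ≤ Λ(t)²`).

Exact calculus; the coefficient `c` (line values, normalisation, pp selection) is the channel reading's and stays abstract; nothing about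
superconductivity is asserted.  0 kit.
-/

noncomputable section

namespace Summit.HubbardSuperconductivity.HubbardSuperconductivity.Theorems.KLRegimeWick

set_option linter.dupNamespace false -- summit = problem name (single-conjunct summit), D-0017

open Set Finset Literature.MathematicalPhysics.QuantumLattice GrassmannAlgebra
open Literature.Probability.LatticeModels
open Summit.HubbardSuperconductivity.HubbardSuperconductivity.Theorems.KLProgrammeLegKernels
open Summit.HubbardSuperconductivity.HubbardSuperconductivity.Theorems.KLRegimeSplit
open scoped Topology

/-! ## §1 Monotonicity of the weights in the scale -/

section Mono

variable (L M : ℕ) (β μ : ℝ) (K : TrigPolyC4v)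

/-- **The weight above scale is ANTITONE in the scale** on `(0, ∞)`: raising `Λ` lowers `χ₂((ω²+e²)/Λ²)`. -/
theorem klws_cutoffWeight_anti_scale {Λ Λ' : ℝ} (hΛ : 0 < Λ) (hΛΛ' : Λ ≤ Λ') (k : FreqMomentum L M) :
    hubbardCutoffWeightCT L M β μ K Λ' k ≤ hubbardCutoffWeightCT L M β μ K Λ k := by
  unfold hubbardCutoffWeightCT
  refine monotone_salmhoferCutoff ?_
  have hE : 0 ≤ matsubaraFreq β M k.1 ^ 2 + nambuXiCT L μ K k.2 ^ 2 := by positivity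
  exact div_le_div_of_nonneg_left hE (by positivity) (pow_le_pow_left₀ hΛ.le hΛΛ' 2)

/-- **The soft weight `1 − w_Λ` is MONOTONE in the scale** on `(0, ∞)`. -/
theorem klws_softWeight_mono_scale {Λ Λ' : ℝ} (hΛ : 0 < Λ) (hΛΛ' : Λ ≤ Λ') (k : FreqMomentum L M) :
    1 - hubbardCutoffWeightCT L M β μ K Λ k ≤ 1 - hubbardCutoffWeightCT L M β μ K Λ' k := by
  have h := klws_cutoffWeight_anti_scale L M β μ K hΛ hΛΛ' k
  linarith

/-- `0 ≤ 1 − w_Λ(k) ≤ 1`. -/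
theorem klws_softWeight_mem_Icc (Λ : ℝ) (k : FreqMomentum L M) :
    1 - hubbardCutoffWeightCT L M β μ K Λ k ∈ Icc (0 : ℝ) 1 := by
  have h := salmhoferCutoff_mem_Icc ((matsubaraFreq β M k.1 ^ 2 + nambuXiCT L μ K k.2 ^ 2) / Λ ^ 2)
  unfold hubbardCutoffWeightCT
  exact ⟨by linarith [h.2], by linarith [h.1]⟩

/-- **Along the affine path `Λ(t) = Λ₀ + t(Λ₁ − Λ₀)`, `0 < Λ₁ ≤ Λ₀`, the soft pair weight `(1 − w_{Λ(t)}(k))(1 − w_{Λ(t)}(k′))` is ANTITONE in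
`t ∈ [0,1]`** (the scale decreases, both factors decrease, both are nonnegative). -/
theorem klws_softWeightPair_antitoneOn_path {Λ₀ Λ₁ : ℝ} (h10 : Λ₁ ≤ Λ₀) (h1 : 0 < Λ₁) (k k' : FreqMomentum L M) :
    AntitoneOn (fun t : ℝ => (1 - hubbardCutoffWeightCT L M β μ K (Λ₀ + t * (Λ₁ - Λ₀)) k) *
      (1 - hubbardCutoffWeightCT L M β μ K (Λ₀ + t * (Λ₁ - Λ₀)) k')) (Icc 0 1) := by
  intro s hs t ht hst
  have hΛt : 0 < Λ₀ + t * (Λ₁ - Λ₀) := h1.trans_le (klws_affine_mem_Icc h10 ht).1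
  have hle : Λ₀ + t * (Λ₁ - Λ₀) ≤ Λ₀ + s * (Λ₁ - Λ₀) := by nlinarith
  exact mul_le_mul (klws_softWeight_mono_scale L M β μ K hΛt hle k) (klws_softWeight_mono_scale L M β μ K hΛt hle k')
    (klws_softWeight_mem_Icc L M β μ K _ k').1 (klws_softWeight_mem_Icc L M β μ K _ k).1

end Mono

/-! ## §2 Tails from monotonicity (generic) -/

section Tails

variable {ι : Type*}

/-- **Tails of a monotone rung are bounded by its full increment**: if `b t a = c a · u t a` with `t ↦ u t a` antitone on `[0,1]`, then for every
`t ∈ [0,1]`, `‖b 1 a − b t a‖ ≤ ‖c a‖·(u 0 a − u 1 a)` — the `hρ` input with `ρ a = ‖c a‖·(u 0 a − u 1 a)` (the absolute value of the full rung). -/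
theorem klws_rung_tail_le_of_antitone (c : ι → ℂ) (u : ℝ → ι → ℝ) (b : ℝ → ι → ℂ) (hb : ∀ t a, b t a = c a * (u t a : ℂ))
    (hanti : ∀ a, AntitoneOn (fun t => u t a) (Icc (0 : ℝ) 1)) {t : ℝ} (ht : t ∈ Icc (0 : ℝ) 1) (a : ι) :
    ‖b 1 a - b t a‖ ≤ ‖c a‖ * (u 0 a - u 1 a) := by
  rw [hb, hb, ← mul_sub, norm_mul, ← Complex.ofReal_sub, Complex.norm_real, Real.norm_eq_abs]
  refine mul_le_mul_of_nonneg_left ?_ (norm_nonneg _)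
  have h1 : u 1 a ≤ u t a := hanti a ht ⟨zero_le_one, le_rfl⟩ ht.2
  have h0 : u t a ≤ u 0 a := hanti a ⟨le_rfl, zero_le_one⟩ ht ht.1
  rw [abs_sub_comm, abs_of_nonneg (by linarith)]
  linarith

/-- The full increment is nonnegative (so `ρ ≥ 0`). -/
theorem klws_rung_increment_nonneg (u : ℝ → ι → ℝ) (hanti : ∀ a, AntitoneOn (fun t => u t a) (Icc (0 : ℝ) 1)) (a : ι) :
    0 ≤ u 0 a - u 1 a :=
  sub_nonneg.2 (hanti a ⟨le_rfl, zero_le_one⟩ ⟨zero_le_one, le_rfl⟩ zero_le_one)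

/-- … and the composite rung `b 1 − b 0` has absolute value EQUAL to the profile: `‖b 1 a − b 0 a‖ = ‖c a‖·(u 0 a − u 1 a)`. -/
theorem klws_rung_composite_norm_eq (c : ι → ℂ) (u : ℝ → ι → ℝ) (b : ℝ → ι → ℂ) (hb : ∀ t a, b t a = c a * (u t a : ℂ))
    (hanti : ∀ a, AntitoneOn (fun t => u t a) (Icc (0 : ℝ) 1)) (a : ι) :
    ‖b 1 a - b 0 a‖ = ‖c a‖ * (u 0 a - u 1 a) := by
  rw [hb, hb, ← mul_sub, norm_mul, ← Complex.ofReal_sub, Complex.norm_real, Real.norm_eq_abs, abs_sub_comm,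
    abs_of_nonneg (klws_rung_increment_nonneg u hanti a)]

end Tails

/-! ## §3 The soft pair weight along the path: derivative, continuity, rate, support -/

section Deriv

variable (L M : ℕ) (β μ : ℝ) (K : TrigPolyC4v)

/-- **Derivative of the soft pair weight along the path** (`hb` input, per entry, before the coefficient `c x`):
`∂_t[(1 − w_{Λ(t)}(k))(1 − w_{Λ(t)}(k′))] = (Λ₁ − Λ₀)·(−ẇ_{Λ(t)}(k)·(1 − w_{Λ(t)}(k′)) − (1 − w_{Λ(t)}(k))·ẇ_{Λ(t)}(k′))`. -/
theorem klws_hasDerivAt_softWeightPair_path {Λ₀ Λ₁ : ℝ} (h10 : Λ₁ ≤ Λ₀) (h1 : 0 < Λ₁) {t : ℝ} (ht : t ∈ Icc (0 : ℝ) 1)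
    (k k' : FreqMomentum L M) :
    HasDerivAt (fun s : ℝ => (1 - hubbardCutoffWeightCT L M β μ K (Λ₀ + s * (Λ₁ - Λ₀)) k) *
        (1 - hubbardCutoffWeightCT L M β μ K (Λ₀ + s * (Λ₁ - Λ₀)) k'))
      ((Λ₁ - Λ₀) * (-deriv (fun Λ' : ℝ => hubbardCutoffWeightCT L M β μ K Λ' k) (Λ₀ + t * (Λ₁ - Λ₀)) *
          (1 - hubbardCutoffWeightCT L M β μ K (Λ₀ + t * (Λ₁ - Λ₀)) k') -
        (1 - hubbardCutoffWeightCT L M β μ K (Λ₀ + t * (Λ₁ - Λ₀)) k) *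
          deriv (fun Λ' : ℝ => hubbardCutoffWeightCT L M β μ K Λ' k') (Λ₀ + t * (Λ₁ - Λ₀)))) t := by
  have hne : Λ₀ + t * (Λ₁ - Λ₀) ≠ 0 := (h1.trans_le (klws_affine_mem_Icc h10 ht).1).ne'
  -- the two weights along the path
  have hw : ∀ q : FreqMomentum L M, HasDerivAt (fun s : ℝ => hubbardCutoffWeightCT L M β μ K (Λ₀ + s * (Λ₁ - Λ₀)) q)
      ((Λ₁ - Λ₀) * deriv (fun Λ' : ℝ => hubbardCutoffWeightCT L M β μ K Λ' q) (Λ₀ + t * (Λ₁ - Λ₀))) t := by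
    intro q
    have hg := (klws_hasDerivAt_cutoffWeight_scale L M β μ K hne q)
    have hd : HasDerivAt (fun Λ' : ℝ => hubbardCutoffWeightCT L M β μ K Λ' q)
        (deriv (fun Λ' : ℝ => hubbardCutoffWeightCT L M β μ K Λ' q) (Λ₀ + t * (Λ₁ - Λ₀))) (Λ₀ + t * (Λ₁ - Λ₀)) :=
      hg.differentiableAt.hasDerivAt
    have hc := hd.scomp t (klws_hasDerivAt_affine Λ₀ Λ₁ t)
    simpa only [Function.comp_def, smul_eq_mul] using hc
  have hu : ∀ q : FreqMomentum L M, HasDerivAt (fun s : ℝ => 1 - hubbardCutoffWeightCT L M β μ K (Λ₀ + s * (Λ₁ - Λ₀)) q)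
      (-((Λ₁ - Λ₀) * deriv (fun Λ' : ℝ => hubbardCutoffWeightCT L M β μ K Λ' q) (Λ₀ + t * (Λ₁ - Λ₀)))) t := by
    intro q
    simpa using (hw q).const_sub 1
  refine ((hu k).mul (hu k')).congr_deriv ?_
  ring

/-- The derivative written as a function of `t` (for the continuity and rate statements). -/
theorem klws_deriv_softWeightPair_path {Λ₀ Λ₁ : ℝ} (h10 : Λ₁ ≤ Λ₀) (h1 : 0 < Λ₁) {t : ℝ} (ht : t ∈ Icc (0 : ℝ) 1)
    (k k' : FreqMomentum L M) :
    deriv (fun s : ℝ => (1 - hubbardCutoffWeightCT L M β μ K (Λ₀ + s * (Λ₁ - Λ₀)) k) *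
        (1 - hubbardCutoffWeightCT L M β μ K (Λ₀ + s * (Λ₁ - Λ₀)) k')) t =
      (Λ₁ - Λ₀) * (-deriv (fun Λ' : ℝ => hubbardCutoffWeightCT L M β μ K Λ' k) (Λ₀ + t * (Λ₁ - Λ₀)) *
          (1 - hubbardCutoffWeightCT L M β μ K (Λ₀ + t * (Λ₁ - Λ₀)) k') -
        (1 - hubbardCutoffWeightCT L M β μ K (Λ₀ + t * (Λ₁ - Λ₀)) k) *
          deriv (fun Λ' : ℝ => hubbardCutoffWeightCT L M β μ K Λ' k') (Λ₀ + t * (Λ₁ - Λ₀))) :=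
  (klws_hasDerivAt_softWeightPair_path L M β μ K h10 h1 ht k k').deriv

/-- `Λ ↦ ẇ_Λ(k)` is continuous at `Λ ≠ 0` (smooth weight). -/
theorem klws_continuousAt_derivCutoffWeight_scale {Λ : ℝ} (hΛ : Λ ≠ 0) (k : FreqMomentum L M) :
    ContinuousAt (fun Λ' : ℝ => deriv (fun Λ'' : ℝ => hubbardCutoffWeightCT L M β μ K Λ'' k) Λ') Λ := by
  have h2 : ContDiffOn ℝ 2 (fun Λ'' : ℝ => hubbardCutoffWeightCT L M β μ K Λ'' k) {Λ : ℝ | Λ ≠ 0} :=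
    klws_contDiffOn_cutoffWeight_scale L M β μ K k
  exact ((h2.continuousOn_deriv_of_isOpen isOpen_ne (by norm_num)).continuousAt (isOpen_ne.mem_nhds hΛ))

/-- `Λ ↦ w_Λ(k)` is continuous at `Λ ≠ 0`. -/
theorem klws_continuousAt_cutoffWeight_scale {Λ : ℝ} (hΛ : Λ ≠ 0) (k : FreqMomentum L M) :
    ContinuousAt (fun Λ' : ℝ => hubbardCutoffWeightCT L M β μ K Λ' k) Λ :=
  (klws_hasDerivAt_cutoffWeight_scale L M β μ K hΛ k).continuousAt

/-- **Continuity of the rung derivative along the path** (`hb'c` input, per entry, before the coefficient `c x`). -/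
theorem klws_continuousOn_softWeightPair_deriv_path {Λ₀ Λ₁ : ℝ} (h10 : Λ₁ ≤ Λ₀) (h1 : 0 < Λ₁) (k k' : FreqMomentum L M) :
    ContinuousOn (fun t : ℝ => (Λ₁ - Λ₀) * (-deriv (fun Λ' : ℝ => hubbardCutoffWeightCT L M β μ K Λ' k) (Λ₀ + t * (Λ₁ - Λ₀)) *
          (1 - hubbardCutoffWeightCT L M β μ K (Λ₀ + t * (Λ₁ - Λ₀)) k') -
        (1 - hubbardCutoffWeightCT L M β μ K (Λ₀ + t * (Λ₁ - Λ₀)) k) *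
          deriv (fun Λ' : ℝ => hubbardCutoffWeightCT L M β μ K Λ' k') (Λ₀ + t * (Λ₁ - Λ₀)))) (Icc 0 1) := by
  intro t ht
  have hne : Λ₀ + t * (Λ₁ - Λ₀) ≠ 0 := (h1.trans_le (klws_affine_mem_Icc h10 ht).1).ne'
  have hp : ContinuousAt (fun s : ℝ => Λ₀ + s * (Λ₁ - Λ₀)) t := (klws_hasDerivAt_affine Λ₀ Λ₁ t).continuousAt
  have hdw : ∀ q : FreqMomentum L M, ContinuousAt
      (fun s : ℝ => deriv (fun Λ' : ℝ => hubbardCutoffWeightCT L M β μ K Λ' q) (Λ₀ + s * (Λ₁ - Λ₀))) t := fun q =>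
    ContinuousAt.comp (f := fun s : ℝ => Λ₀ + s * (Λ₁ - Λ₀)) (x := t) (klws_continuousAt_derivCutoffWeight_scale L M β μ K hne q) hp
  have hcw : ∀ q : FreqMomentum L M, ContinuousAt
      (fun s : ℝ => hubbardCutoffWeightCT L M β μ K (Λ₀ + s * (Λ₁ - Λ₀)) q) t := fun q =>
    ContinuousAt.comp (f := fun s : ℝ => Λ₀ + s * (Λ₁ - Λ₀)) (x := t) (klws_continuousAt_cutoffWeight_scale L M β μ K hne q) hp
  exact (continuousAt_const.mul (((hdw k).neg.mul (continuousAt_const.sub (hcw k'))).sub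
    ((continuousAt_const.sub (hcw k)).mul (hdw k')))).continuousWithinAt

/-- **Rate bound**: along the path, `|∂_t[(1 − w(k))(1 − w(k′))]| ≤ |Λ₁ − Λ₀|·(128/3)/Λ₁` (each `|ẇ_{Λ(t)}| ≤ (64/3)/Λ(t) ≤ (64/3)/Λ₁`, each soft
weight in `[0,1]`). -/
theorem klws_abs_softWeightPair_deriv_le {Λ₀ Λ₁ : ℝ} (h10 : Λ₁ ≤ Λ₀) (h1 : 0 < Λ₁) {t : ℝ} (ht : t ∈ Icc (0 : ℝ) 1)
    (k k' : FreqMomentum L M) :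
    |(Λ₁ - Λ₀) * (-deriv (fun Λ' : ℝ => hubbardCutoffWeightCT L M β μ K Λ' k) (Λ₀ + t * (Λ₁ - Λ₀)) *
          (1 - hubbardCutoffWeightCT L M β μ K (Λ₀ + t * (Λ₁ - Λ₀)) k') -
        (1 - hubbardCutoffWeightCT L M β μ K (Λ₀ + t * (Λ₁ - Λ₀)) k) *
          deriv (fun Λ' : ℝ => hubbardCutoffWeightCT L M β μ K Λ' k') (Λ₀ + t * (Λ₁ - Λ₀)))| ≤
      |Λ₁ - Λ₀| * (128 / 3 / Λ₁) := by
  set Λ := Λ₀ + t * (Λ₁ - Λ₀) with hΛ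
  have hΛ1 : Λ₁ ≤ Λ := (klws_affine_mem_Icc h10 ht).1
  have hΛ0 : 0 < Λ := h1.trans_le hΛ1
  have hd : ∀ q : FreqMomentum L M, |deriv (fun Λ' : ℝ => hubbardCutoffWeightCT L M β μ K Λ' q) Λ| ≤ 64 / 3 / Λ₁ := fun q =>
    (klws_abs_deriv_cutoffWeight_scale_le L M β μ K hΛ0.ne' q).trans (by
      rw [abs_of_pos hΛ0]
      exact div_le_div_of_nonneg_left (by norm_num) h1 hΛ1)
  have hu : ∀ q : FreqMomentum L M, |1 - hubbardCutoffWeightCT L M β μ K Λ q| ≤ 1 := fun q => by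
    have h := klws_softWeight_mem_Icc L M β μ K Λ q
    rw [abs_of_nonneg h.1]; exact h.2
  rw [abs_mul]
  refine mul_le_mul_of_nonneg_left ?_ (abs_nonneg _)
  calc |(-deriv (fun Λ' : ℝ => hubbardCutoffWeightCT L M β μ K Λ' k) Λ * (1 - hubbardCutoffWeightCT L M β μ K Λ k') -
        (1 - hubbardCutoffWeightCT L M β μ K Λ k) * deriv (fun Λ' : ℝ => hubbardCutoffWeightCT L M β μ K Λ' k') Λ)|
      ≤ |deriv (fun Λ' : ℝ => hubbardCutoffWeightCT L M β μ K Λ' k) Λ| * |1 - hubbardCutoffWeightCT L M β μ K Λ k'| +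
          |1 - hubbardCutoffWeightCT L M β μ K Λ k| * |deriv (fun Λ' : ℝ => hubbardCutoffWeightCT L M β μ K Λ' k') Λ| := by
        refine (abs_sub _ _).trans ?_
        rw [abs_mul, abs_mul, abs_neg]
    _ ≤ 64 / 3 / Λ₁ * 1 + 1 * (64 / 3 / Λ₁) := by
        gcongr
        · exact hd k
        · exact hu k'
        · exact hu k
        · exact hd k'
    _ = 128 / 3 / Λ₁ := by ring

/-- **Support of the rate**: the derivative vanishes unless one of the two legs lies in the shell of scale `Λ(t)`,
`Λ(t)²/4 ≤ ω² + e_K² ≤ Λ(t)²`. -/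
theorem klws_softWeightPair_deriv_eq_zero {Λ₀ Λ₁ : ℝ} (h10 : Λ₁ ≤ Λ₀) (h1 : 0 < Λ₁) {t : ℝ} (ht : t ∈ Icc (0 : ℝ) 1)
    (k k' : FreqMomentum L M)
    (hk : matsubaraFreq β M k.1 ^ 2 + nambuXiCT L μ K k.2 ^ 2 < (Λ₀ + t * (Λ₁ - Λ₀)) ^ 2 / 4 ∨
      (Λ₀ + t * (Λ₁ - Λ₀)) ^ 2 < matsubaraFreq β M k.1 ^ 2 + nambuXiCT L μ K k.2 ^ 2)
    (hk' : matsubaraFreq β M k'.1 ^ 2 + nambuXiCT L μ K k'.2 ^ 2 < (Λ₀ + t * (Λ₁ - Λ₀)) ^ 2 / 4 ∨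
      (Λ₀ + t * (Λ₁ - Λ₀)) ^ 2 < matsubaraFreq β M k'.1 ^ 2 + nambuXiCT L μ K k'.2 ^ 2) :
    (Λ₁ - Λ₀) * (-deriv (fun Λ' : ℝ => hubbardCutoffWeightCT L M β μ K Λ' k) (Λ₀ + t * (Λ₁ - Λ₀)) *
          (1 - hubbardCutoffWeightCT L M β μ K (Λ₀ + t * (Λ₁ - Λ₀)) k') -
        (1 - hubbardCutoffWeightCT L M β μ K (Λ₀ + t * (Λ₁ - Λ₀)) k) *
          deriv (fun Λ' : ℝ => hubbardCutoffWeightCT L M β μ K Λ' k') (Λ₀ + t * (Λ₁ - Λ₀))) = 0 := by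
  have hne : Λ₀ + t * (Λ₁ - Λ₀) ≠ 0 := (h1.trans_le (klws_affine_mem_Icc h10 ht).1).ne'
  rw [klws_deriv_cutoffWeight_scale_eq_zero L M β μ K hne k hk, klws_deriv_cutoffWeight_scale_eq_zero L M β μ K hne k' hk']
  ring

end Deriv

end Summit.HubbardSuperconductivity.HubbardSuperconductivity.Theorems.KLRegimeWick

end
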